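import Mathlib
import HarnessLib
import HarnessLib.Audit
import Summits.ResolutionOfSingularities.Statement
import HarnessLib.Audit.Status.Attr

/-!
Route: FrobeniusClosing

# Route FrobeniusClosing — eternal forced runs are periodic over a finite field — decide the
isolated core by a complete cycle search, steer the rest

Operator computational-witness. It suffices to show X = N ∧ B ∧ C ∧ S ∧ T ∧ P ∧ D, whose spine is
the CLOSING LEMMA of arithmetic
dynamics (Hrushovski–Varshavsky twisted Lang–Weil): in characteristic p a constructible process on a
finite-type arena runs forever
over SOME field only if it runs IN A CIRCLE over a FINITE field. Arena: height-one atoms z^p =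
a(u_1..u_n) over κ[[u]] (κ perfect) at
ISOLATED points of multiplicity p (Milnor-type colength μ(a) = dim κ[[u]]/(∂a) finite = finitely
determined, BoubakriGreuelMarkwig2010),
successor = any isolated multiplicity-p closed point of the blow-up of the point (chart i,
translation τ, the coefficient calculus of
route ShadowGame with the centre FORCED to be the point). N = NoPeriodicIsolatedAtom (rank 2, THE
CERTIFICATE): over fields algebraic
over F_p no such chain returns to an isomorphic pair (κ[[u]], [a]) — decidable per (p, n, μ-bound)
by two dual searches, a finite explicit
witness if false; B = BoundedMilnor (rank 4): μ stays bounded along every infinite isolated chain; C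
= ClosingReduction (rank 5): N → B →
IsolatedForcedTermination (no infinite chain of isolated multiplicity-p infinitely near points, over
every perfect field); IsolatedForcedTermination is the TARGET (rank 0, derived in `closes`); S =
Steer (rank 3): that termination ⇒ local uniformization of
α_p-torsors over perfect fields (TorsorLUPerfect, support, = ShadowGame's target stmt-16158
verbatim); T, P, D = TorsorToLurelPerfect, PatchingRelPerfect, DescentPerfectToAll (ShadowGame's
chain, stmt-16162 /
16161 / 0549 verbatim). Cards realised: frobenius-closes-the-orbit-v2 (spine, critic grade
new-mechanism, unrouted),
dim4-is-zero-dimensional-tjurina-descent (the isolated arena, IsoDrop), moh-window-forced-runs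
(forcedness / window).
Lean: `NoPeriodicIsolatedAtom ∧ BoundedMilnor ∧ ClosingReduction ∧ Steer ∧ TorsorToLurelPerfect ∧
PatchingRelPerfect ∧ DescentPerfectToAll`

## Assembly
Pure logic (Sketch.lean / glue.lean: lean check rc 0, 0 sorries, `closes` axioms propext ·
Classical.choice · Quot.sound): ClosingReduction
applied to NoPeriodicIsolatedAtom and BoundedMilnor gives the target IsolatedForcedTermination;
Steer turns it into TorsorLUPerfect's body; at a prime p,
TorsorToLurelPerfect gives relative LU over perfect k, PatchingRelPerfect resolution over perfect k,
DescentPerfectToAll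
ResolutionInChar p; the summit is ∀ p, p.Prime → ResolutionInChar p by definition:
`closes hNP hBT hCR hS hT hP hD := fun p hp => hD p hp (hP p hp (hT p hp (hS (hCR hNP hBT) p hp)))`.

Rationale: WHY THIS LINE. Every positive-characteristic divergence in print pumps unbounded data
(HauserPerlega2019 §4: residual order → ∞ along unforced point
blow-ups; Kollar2007 Ex. 1.104: Nagata's ring reproduces itself after one blow-up only by
re-indexing infinitely many p-independent
x_i), and Hauser–Perlega 'were not able to construct examples with cycles where the choice of point
centers is forced (e.g., because the
singularities are isolated)' (arXiv:1802.05010 §1). The closing lemma (Varshavsky2014 Thm 1/Cor 2 =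
Hrushovski2004 Cor 1.2, plus
Noetherian induction over dead ends; transplant precedents Fakhruddin2002 Prop 5.5, Borisov–Sapir)
turns this into a theorem-shaped
dichotomy on the finitely determined (isolated, BoubakriGreuelMarkwig2010) core: an eternal isolated
forced chain over ANY field with
bounded μ is a PERIODIC chain over a finite field, i.e. an explicit polynomial a ∈ F_q[u] and a
finite word of charts/points — so the
forced core of local uniformization is decided by a complete pair of searches per (p, n, μ ≤ β)
(enumerate cycles over F_{p^m} ∥ iterate
the constructible sets E_N of states with a length-N future until empty), and 'transcendentally
forced' counterexamples cannot exist
alone. Imported areas: arithmetic dynamics / model theory of difference fields (twisted Lang–Weil),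
singularity theory in char p
(finite determinacy), symbolic computation (Gröbner emptiness certificates, orbit enumeration over
finite fields). No listed route has a
finite-field reduction, a periodicity statement or a forced/unforced split: ShadowGame synthesises a
strategy and certifies it by
ranking functions; Valuative/CyclicCovers/IndSmooth attack the same target valuation-theoretically;
WeightedInvariant/MarkedTransfer
want a dropping invariant — here increases are allowed, only recurrence and unbounded growth are
excluded.

RANKED CRUXES. #0 IsolatedForcedTermination (target) — the TARGET (IsoDrop for height-one atoms, all
n, all perfect fields): no start series, chart sequence and translation sequence over a perfect
field of char p yields an INFINITE run of the point-blow-up dynamics all of whose states are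
isolated of multiplicity p. Derived in `closes` as ClosingReduction NoPeriodicIsolatedAtom
BoundedMilnor; provable directly by anyone with a budget (a ranking on μ-bounded states) — char 2
looks like a budget regime (spine card toy B: μ drops by a constant at every forced step, ~290
steps, n = 3,4,5); consumed by Steer. (why it might fail: An isolated forced cycle
(¬NoPeriodicIsolatedAtom) or a μ-pumping eternal isolated chain (¬BoundedMilnor) refutes it; both
are exactly Hauser–Perlega's missing 'forced' examples, unknown for p ≥ 3, n ≥ 4.)
[arXiv:1802.05010, arXiv:1412.0868, BoubakriGreuelMarkwig2010, Varshavsky2014]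
#2 NoPeriodicIsolatedAtom (crux) — THE CERTIFICATE (card frobenius-closes-the-orbit-v2 K2, typed).
For every prime p, n ≥ 1 and field κ ALGEBRAIC over F_p: no start a₀ = c₀ (coefficient function), no
word of charts i_m and translations t_m ∈ κ and no r ≥ 1 such that all states c_0..c_r of the
point-blow-up dynamics (blow up the closed point; in chart i the strict transform divides z^p = a by
u_i^p, i.e. z ↦ z/u_i; pass to the closed point u_j = τ_j (j ≠ i) of the exceptional divisor; delete
p-th-power monomials = reduce a mod κ[[u]]^p) are ISOLATED (κ[[u]]/(∂_1 a, …, ∂_n a) finite over κ)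
of multiplicity p (cleaned order ≥ p), and (κ[[u]], [a_r]) ≅ (κ[[u]], [a_0]) as pairs (∃
κ-automorphism φ of κ[[u]], unit v, g with φ(a_0) = v^p a_r + g^p). COMPUTE-SEAT JOB SPEC (first
source): for (p,n) ∈ {2,3,5}×{3,4,5} enumerate cleaned polynomial states over F_p, F_{p^2}, F_{p^3}
with μ ≤ β (β = 20, 40), compute all isolated multiplicity-p successors (n charts × translations in
F_{p^m}, m ≤ 3), quotient by pair-isomorphism via the (2μ−ord+2)-jet normal form, and (a) search the
finite successor graph for CYCLES, (b) dually iterate E_N = states with an isolated forced future of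
length N until E_N = ∅ (Gröbner/linear algebra over F_p[t]: emptiness certificate); exactly one of
(a)/(b) halts per (p, n, β). A cycle is a Theorems-level explicit eternal forced run
(Hauser–Perlega's missing object); E_N = ∅ proves the (p,n,β) instance. [difficulty: open-problem]
(why it might fail: A self-reproducing isolated atom over some F_q (a forced Hauser–Perlega cycle)
may simply exist for p ≥ 3, n ≥ 4 — toy C of the spine card already shows μ rising 9→12 at a
verified forced step (p = 3, n = 4); nothing known excludes it.) [arXiv:1802.05010, Varshavsky2014,
BoubakriGreuelMarkwig2010, arXiv:1412.0868, arXiv:2602.06553, Kollar2007]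
#3 Steer (crux) — STEERING: if no perfect field carries an infinite chain of isolated multiplicity-p
infinitely near points of a height-one atom (IsolatedForcedTermination, the target), then
α_p-torsors over bases regular at the centre are uniformizable along every valuation over every
perfect field (the body of TorsorLUPerfect, inlined). Content: at NON-isolated (unforced) stages a
positive-dimensional permissible centre through the centre of the valuation exists; choose it
(maximal E-permissible coordinate stratum, CossartPiltant2019-style) and show the run returns to the
isolated regime or drops multiplicity — the dictionary model/valuation ↔ coefficient dynamics is
ShadowGame's WinToTorsorLU (0-dimensional reduction NovacoskiSpivakovsky2014, Cohen coefficient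
fields over perfect κ, toroidal endgame Kato1994/Niziol2006). [deps: ClosingReduction] [difficulty:
open-problem] (why it might fail: The unforced regime may carry the whole difficulty (CP Rem 3.2: ω
rises under a permissible centre in dim 4; HP cycles are unforced): then 'given forced termination'
buys nothing and Steer is LuAlphaPTorsor again.) [arXiv:1412.0868, arXiv:1802.05010,
CutkoskyMourtada2019, NovacoskiSpivakovsky2014, Temkin2013,
Literature.Barriers.ResolutionOfSingularities.DimensionFourFrontier]
#4 BoundedMilnor (crux) — NO PUMPING (card K1): along every infinite chain of isolated
multiplicity-p states of the point-blow-up dynamics over a perfect field, the Milnor-type colength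
μ(a_m) = dim κ[[u]]/(∂a_m) is bounded. Strictly weaker than termination (implied by it vacuously);
it is the one geometric input the closing lemma needs (bounded μ ⇒ the chain lives in one
finite-type determinacy quotient). [difficulty: L] (why it might fail: μ is not known to be monotone
under point blow-ups in dim ≥ 3 even in char 0; a kangaroo-type re-coordinatisation could pump μ
without bound along an eternal isolated chain (an isolated analogue of HauserPerlega2019's
residual-order growth), making closing silent.) [arXiv:1802.05010, BoubakriGreuelMarkwig2010,
arXiv:1005.4503, Kollar2007]
#5 ClosingReduction (crux) — CLOSING REDUCTION: NoPeriodicIsolatedAtom → BoundedMilnor →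
IsolatedForcedTermination. Proof plan (paper-complete modulo the named facts): (i) finite-type arena
W_β = cleaned (2β+2)-jets with μ ≤ β and order ≥ p, pair-isomorphism = orbit relation of a truncated
algebraic group (constructible), successor correspondence T_β constructible by Chevalley, EXACT on
classes by finite determinacy (BoubakriGreuelMarkwig2010: μ < ∞ ⇒ right-(2μ−ord+2)-determined; our
group contains right equivalence); (ii) ClosingLemma (support item; Varshavsky2014 Thm 1 + Cor 2,
induction over dead ends) gives a periodic T_β-path over a finite field from any infinite one; (iii)
unwinding: transport successor points along pair isomorphisms to realise the periodic class-path as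
an honest run over F̄_p, contradicting NoPeriodicIsolatedAtom. [deps: NoPeriodicIsolatedAtom,
BoundedMilnor] [difficulty: L] (why it might fail: Two leaks: pair-group (φ, v^p·, +g^p) determinacy
must be re-derived from BGM right-determinacy (chains base-change to κ̄: likely routine); the
closing lemma's dead-end induction for correspondences (card P1) is hand-checked only — if it needs
extra hypotheses the arena must be refined.) [Varshavsky2014, Hrushovski2004,
BoubakriGreuelMarkwig2010, Fakhruddin2002, doi:10.14231/ag-2022-020]
#6 PatchingRelPerfect (crux) — Zariski patching over PERFECT ground fields (verbatim ShadowGame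
stmt-16161; fibrewise Valuative's PatchingRel stmt-0642 restricted to perfect k): relative local
uniformization for all f.g. K/k, k perfect of char p ⇒ every reduced separated finite-type scheme
over every perfect field of char p has a resolution. [difficulty: open-problem] (why it might fail:
Patching LUs into one proper regular model is known only in dim ≤ 3 (Zariski; CossartPiltant2008
Prop 4.9 / Piltant2013 need embedded resolution one dimension down); in dim ≥ 4 no reduction Res ⇐
LU exists even in char 0 (CutkoskyMourtada2019 p.3).) [CutkoskyMourtada2019, Temkin2013,
CossartPiltant2019, NovacoskiSpivakovsky2014,
Literature.Barriers.ResolutionOfSingularities.DimensionFourFrontier]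
#7 TorsorToLurelPerfect (crux) — Temkin's inseparable reduction over PERFECT ground fields (verbatim
ShadowGame stmt-16162): LU of α_p-torsors over bases regular at the centre (TorsorLUPerfect at p) ⇒
relative LU for every f.g. K/k, k perfect of char p (Temkin2013 Thm 1.3.2 + Frobenius transport +
the degree-p radical tower). [difficulty: L] (why it might fail: Rests on Temkin2013 Thm 1.3.2
(vendored fact with an unproved leaf in tree: Temkin2013RelativeCurveSmoothFibre) and on Temkin's
model dominating the GIVEN R, which needs his relative form; smooth ≠ regular bookkeeping at each
tower step.) [Temkin2013, arXiv:0804.1554,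
Literature.AlgebraicGeometry.Resolution.Temkin2013Relative,
Literature.Barriers.ResolutionOfSingularities.InseparableBaseChange]
#8 DescentPerfectToAll (crux) — perfect fields ⇒ all fields (verbatim stmt-0549, shared with Descent
/ WeightedInvariant / UniformComplexity / CleanCovers / MarkedTransfer / ShadowGame /
UniversalCells): for a prime p, resolution of all reduced separated finite-type schemes over all
PERFECT fields of char p implies ResolutionInChar p. [difficulty: open-problem] (why it might fail:
Only known mechanism spreads X over a f.g. field of definition and base-changes a resolution over a
perfect subfield back; regular is not geometrically regular under inseparable extension (EGA IV
6.7.4), e.g. k = F_p((t)) (Temkin2008 Question 3.3.3 open).) [arXiv:math/0703678, Kollar2007,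
Literature.Barriers.ResolutionOfSingularities.InseparableBaseChange,
Literature.Barriers.ResolutionOfSingularities.RegularNotGeometricallyRegular]
#9 TorsorLUPerfect (support) — local uniformization of α_p-torsors over bases regular at the centre,
over PERFECT ground fields (verbatim ShadowGame's target stmt-16158 = Valuative's LuAlphaPTorsor
stmt-0641 with [PerfectField k]); the consequent of Steer and the antecedent of TorsorToLurelPerfect
(inlined there); listed so that the shared item carries this route too. [difficulty: open-problem]
[Temkin2013, CutkoskyMourtada2019, CossartPiltant2019,
Literature.Barriers.ResolutionOfSingularities.DimensionFourFrontier]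
#9 ClosingLemma (support) — THE CLOSING LEMMA, affine constructible form (card P1): p prime, T ⊆ A^N
× A^N a constructible set defined over F_p (finite union of V(P_j) ∖ V(Q_j)); if T has an infinite
path with vertices in K^N for SOME field K of characteristic p, then T has a PERIODIC path with
vertices in F^N for some FINITE field F. Proof: survivor sets are constructible and non-empty over
F̄_p; on a bi-dominant irreducible piece Varshavsky2014 Thm 1/Cor 2 (the graph of Frob_q^m meets it,
densely) gives an honest path γ with last(γ) = Frob^m(first(γ)) off every bad locus, iterated by
F_q-equivariance to a periodic path; otherwise pass to a lower-dimensional closed sub-arena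
(induction on dimension; dim 0 = pigeonhole). Needs the twisted Lang–Weil estimate as a vendored
Literature fact (cite item filed). [difficulty: M] [Varshavsky2014, Hrushovski2004, Fakhruddin2002,
doi:10.14231/ag-2022-020]

TWO-LAYER PLAN. Foreseen glued splits, filed only after a census: NoPeriodicIsolatedAtom ⇐ NP_le2 (n
≤ 2, curve/surface atoms: calibration expected
from surface theory, first to close) → NP_rigid (all n: a self-reproducing isolated pair carries a
discrete self-similarity x ↦ x^M;
rigidity: such a pair is weighted-homogeneous, and weighted-homogeneous isolated atoms exit the
multiplicity-p regime in boundedly many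
forced steps; n = 3 is the first informative instance) → NoPeriodicIsolatedAtom; ClosingReduction ⇐
PairDeterminacy (BGM
for the pair group) → ArenaConstructible (T_β constructible, exact on classes) → ClosingReduction
(with the support ClosingLemma);
Steer ⇐ UnforcedReturn (an unforced stage admits a permissible coordinate-stratum centre after
which, along the valuation, the run is
isolated again or multiplicity drops, within boundedly many steps) → Dictionary (= ShadowGame's
WinToTorsorLU bookkeeping) → Steer.

KILL CRITERIA. (i) A PERIODIC ISOLATED ATOM found by the rank-2 search (an explicit a ∈
F_q[u_1..u_n], word, r) refutes NoPeriodicIsolatedAtom and is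
filed as such (Theorems-level ¬, with the cycle as kernel-checkable data: it is Hauser–Perlega's
missing forced cycle and refutes every
'blow up regular centres inside the singular locus' format for that hypersurface); the route then
closes `refuted:NoPeriodicIsolatedAtom`
unless the cycle is non-normal-only (then repair: add the normalisation move to the dynamics as item
NoPeriodicIsolatedAtomN, once).
(ii) μ provably unbounded along an explicit infinite isolated chain refutes BoundedMilnor AND
IsolatedForcedTermination: close
`refuted:BoundedMilnor` (closing is silent there; the arena is wrong). (iii) ¬PatchingRelPerfect or
¬DescentPerfectToAll proved ⇒ the
whole LU family (Valuative, CyclicCovers, IndSmooth, ShadowGame, this) dies at that node; close with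
them. (iv) TorsorLUPerfect /
LuAlphaPTorsor (stmt-0641) proved elsewhere moots ranks 2–5 (close `superseded --by` that route);
ShadowGameWin proved moots Steer only
(IsolatedForcedTermination is then a corollary, NoPeriodicIsolatedAtom stays wanted as the negative
census).

NOT DECOMPOSED YET. The dead-end induction inside ClosingLemma, pair-determinacy and arena
constructibility (layer-2 children of ClosingReduction); the
unforced-return lemma inside Steer (its shape depends on which permissible-centre rule provers
adopt; deliberately not fixed at open —
Steer is stated rule-free); the imperfect-field arena (wound points: routed through
DescentPerfectToAll exactly as ShadowGame does, not
through residue-field registers); any GAME version of the closing lemma (∀∃ alternation; card K3) —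
not needed because the centre is
forced in the isolated regime and Steer absorbs the rest; weighted / non-point centres at isolated
points (outside the format by design:
a periodic witness is news precisely because the point is forced for regular centres inside Sing).

CHEAPEST FALSIFIER. Run the rank-2 job at its smallest size: p ∈ {2,3}, n ∈ {3,4}, states over F_p
and F_{p^2} of degree ≤ 6 with μ ≤ 20, successors with
translations in F_{p^2}, cycle search to depth 12 modulo pair-isomorphism (jet normal forms) — a kit
job of hours. A cycle kills
NoPeriodicIsolatedAtom (and is a result); no cycle plus E_N = ∅ for small β is the first certified
instance. Done locally this session
(toy/chain.py, prime-field translations only, exact recurrence up to variable permutation, μ by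
stabilised colength): (p,n) =
(2,2),(3,2),(2,3),(3,3),(2,4), random starts of degree ≤ 5, depth ≤ 8: 44+28+24+14+11 isolated
starts, 379 nodes, longest isolated
chain 5, μ NEVER rose, 0 recurrences — consistent with the spine card's kit toys (j004629: char 2
monotone; j004673: p = 3, n = 4 one
rise 9→12, bounded). The informative regime (p ≥ 3, n ≥ 4, non-prime-field points, special starts)
is untouched by the toy.

NUMBERS. Finite determinacy bound: μ < ∞ ⇒ right-(2μ − ord + 2)-determined
(BoubakriGreuelMarkwig2010, arXiv:1005.4503 §1). Forced window: along
Samuel-forced runs of z^p + F the intrinsic order stays in [p, 2p−2] (moh-window-forced-runs W1/W2: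
for plain point blow-ups d ≥ 2p makes
every point of E multiplicity p, hence non-isolated). Calibration by dimension of the atom (= n): n
≤ 2 (curve/surface atoms) — no isolated
cycles expected from surface theory (toy: longest chain 5); n = 3 is ALREADY informative although
resolution holds in dimension 3, because
CossartPiltant2019's morphism 'is not constructed as a composition of Hironaka-permissible blowing
ups' (arXiv:1412.0868 §1) — a forced
isolated cycle on a threefold atom would separate the permissible format from resolvability; n ≥ 4
is the summit's open range.
Spine-card toys: ≈560 forced steps at p = 2,3, n = 3,4,5: one μ_H rise 9→12 (p = 3, n = 4), no
cycle; this session's toy: 379 isolated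
nodes, 0 rises, 0 recurrences (p ≤ 3, n ≤ 4, prime-field points). Items at open: 11 (1 target, 7
cruxes, 2 supports, 1 assembly).

DEFINITION REQUESTS. None required at open: the dynamics is inlined (`let`-bound coefficient
calculus, ≈2.2k chars per statement, elaborates; identical move
generator to ShadowGame's `step` with the centre fixed to the point and the division fixed to
u_i^p). Cite fact wanted (filed right after
open): Varshavsky2014 Thm 1 / Cor 2 (twisted Lang–Weil for correspondences: c : C → X × X with c₁,
c₂ dominant over F_q ⇒ c⁻¹(Γ_{Frob^n}) ≠ ∅
for n ≫ 0, Zariski dense in C) as `Literature/AlgebraicGeometry/…` named fact, needed by provers of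
ClosingLemma. Optional hygiene later: a
Theorems-side definition `AtomPointStep p n κ` factoring the inlined dynamics (shared with
ShadowGame's TorsorShadowStep request) — to be
filed only if provers ask; re-pointing by `set-signature` does not change meaning.

Novelty: Searches (2026-08-16): `lean search 'Varshavsky' / 'LangWeil' / 'Hrushovski'` (tree: Lang–Weil only
in ModelTheory/PseudofiniteFields and
Valiant routes; no twisted Lang–Weil, no Varshavsky); `lit vsearch "a singularity which reappears,
up to isomorphism, at an infinitely near
point after finitely many blow-ups…"` (8 docs: Kollar2007 pp. 27–28/57–60/79 — infinitely near
singularities of curves; Ex. 1.104 Nagata's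
self-reproducing NON-excellent ring; 2.29 the Z/p-quotient loop under equivariant blow-ups in char 0
— both calibrate the lemma, neither is
a forced cycle of a variety; Casas-Alvero, Kiyek–Vicente: plane-curve infinitely near points, always
finite); `lit galaxy search "twisted
Lang-Weil" --star all` (1 row, Pyber–Szabó growth in groups), `"infinitely near" --star pdf` (8,
none dynamical), `"forced cycle" --star pdf`
(6, noise); remote OpenAlex 429 / s2 / zbMATH / arXiv 0 rows this session (recorded; the spine
card's 2026-08-15 searches — 14 zbMATH/arXiv
queries, galaxy 'graph of Frobenius' / 'quasi-fixed point' — found no use of Hrushovski–Varshavsky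
on blow-ups or resolution and were
re-verified by the mechanism critic 2026-08-16T00:21Z, grade new-mechanism); ledger: all 17 open
route files read (none has a finite-field
reduction, a periodicity statement or a forced/unforced split; ShadowGame read in full), `ledger
negatives` (0), idea list (184; the four
open new-mechanism cards read; spine card unrouted).
Nearest prior art found: Varshavsky2014 (arXiv:1405.6381 Th  [refs: 1405.6381, math/0406514, Kollar2007, Varshavsky2014, Hrushovski2004, Fakhruddin2002, HauserPerlega2019]

Barriers (technique_class: closing-lemma, arithmetic-dynamics, determinacy-quotient): - technique_class: closing-lemma, arithmetic-dynamics, determinacy-quotient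
- Literature.Barriers.ResolutionOfSingularities.Hauser2003_kangarooShadeIncrease: evaded by object —
no shade, residual order or
  lexicographic invariant is tracked and increases are allowed; a kangaroo jump is an edge of the
correspondence; only RECURRENCE (rank 2)
  and UNBOUNDED GROWTH of μ (rank 4) are excluded.
- Literature.Barriers.ResolutionOfSingularities.hauserPerlega_mohProofBoundFails: consistent and
explanatory — their divergent runs are
  unforced (non-isolated) with residual order → ∞, outside every finite-type quotient; the closing
lemma PREDICTS that shape (bounded-data
  eternal runs would be periodic over F_q); BoundedMilnor is where an isolated analogue could
re-enter (conceded, rank 4).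
- Literature.Barriers.ResolutionOfSingularities.DimensionFourFrontier: it applies — Steer and
PatchingRelPerfect are open exactly there; the
  bet is that the genuinely new n-dimensional object (a forced cycle) lives in the isolated core,
which this route decides completely, and
  that steering through unforced stages is the part other routes' tools (CP-style permissible
centres, ShadowGame's synthesis) address.
- Literature.Barriers.ResolutionOfSingularities.DirectrixSmallCharacteristicNarrow: not used — no
directrix / near-point confinement
  (CJS Thm 3.14) enters; successors are ALL isolated multiplicity-p points above, found by
computation, not predicted.
- Literature.Barriers.ResolutionOfSingu

History (route lifecycle, newest last):
- 2026-08-26T12:40:30Z · DORMANT — reconciler: no traction for 7.9 d (last activity item-evidence-added at 2026-08-18T15:33:26Z); parked, not closed — `ledger route dormant route-ResolutionOfSing (operator:999:2552463)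
- 2026-08-26T14:55:27Z · REACTIVATED — director-resolution L0 tranche seated (D-0089 rescue); operator clears dormancy (operator:999:3548499)
- 2026-08-26T15:41:12Z · DORMANT — reconciler: no traction for 8 d (last activity item-evidence-added at 2026-08-18T15:33:26Z); parked, not closed — `ledger route dormant route-ResolutionOfSingul (operator:999:2629219)
- 2026-08-26T16:24:48Z · REACTIVATED — dormant cleared (operator:999:1026125)

sub-problem: ResolutionOfSingularities · status: open · opened planner-plan-novel-ResolutionOfSingularities-Re-dc19aa3a-d-v2-g5-0 2026-08-16T18:37:19Z · rev 1 · ledger route-ResolutionOfSingularities-FrobeniusClosing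
GENERATED by the gate from the ledger (D-0016/17). Provers cite these decls: `theorem foo : Summit.ResolutionOfSingularities.ResolutionOfSingularities.Theses.FrobeniusClosing.<Decl> := …` in Summits/ResolutionOfSingularities/ResolutionOfSingularities/Theorems/<Name>.lean.
-/

namespace Summit.ResolutionOfSingularities.ResolutionOfSingularities.Theses.FrobeniusClosing

open scoped BigOperators Topology Manifold Classical MeasureTheory ProbabilityTheory Matrix InnerProductSpace ComplexConjugate ContinuousMap
open Filter Set Function TopologicalSpace MeasureTheory

attribute [summit_statement] _root_.ResolutionOfSingularities

/-- item stmt-ResolutionOfSingularities-16343 · target · rank 0 · closed · proved by Summit.ResolutionOfSingularities.ResolutionOfSingularities.Theorems.WildCones.IsolatedForcedTermination_proof (prover) · by planner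
why it might fail: An isolated forced cycle (¬NoPeriodicIsolatedAtom) or a μ-pumping eternal isolated chain (¬BoundedMilnor) refutes it; both are exactly Hauser–Perlega's missing 'forced' examples, unknown for p ≥ 3, n ≥ 4.
sources: arXiv:1802.05010, arXiv:1412.0868, BoubakriGreuelMarkwig2010, Varshavsky2014
[target] the TARGET (IsoDrop for height-one atoms, all n, all perfect fields): no start series,
chart sequence and translation sequence over a perfect field of char p yields an INFINITE run of the
point-blow-up dynamics all of whose states are isolated of multiplicity p. Derived in `closes` as
ClosingReduction NoPeriodicIsolatedAtom BoundedMilnor; provable directly by anyone with a budget (a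
ranking on μ-bounded states) — char 2 looks like a budget regime (spine card toy B: μ drops by a
constant at every forced step, ~290 steps, n = 3,4,5); consumed by Steer. -/
@[route_item "route-ResolutionOfSingularities-FrobeniusClosing", crux]
def IsolatedForcedTermination : Prop :=
  ∀ p : ℕ, p.Prime → ∀ n : ℕ, 0 < n → ∀ (κ : Type) [Field κ] [CharP κ p] [PerfectField κ] (c₀ : (Fin n → ℕ) → κ) (i : ℕ → Fin n) (t : ℕ → Fin n → κ), let clean : ((Fin n → ℕ) → κ) → ((Fin n → ℕ) → κ) := fun c A => @ite κ (∀ j, p ∣ A j) (Classical.dec _) 0 (c A); let bl : Fin n → ((Fin n → ℕ) → κ) → ((Fin n → ℕ) → κ) := fun i c B => @ite κ (Finset.sum (Finset.univ.erase i) (fun j => B j) ≤ B i) (Classical.dec _) (c (Function.update B i (B i - Finset.sum (Finset.univ.erase i) (fun j => B j)))) 0; let ord : ((Fin n → ℕ) → κ) → ℕ := fun c => sInf {m : ℕ | ∃ A, c A ≠ 0 ∧ m = Finset.sum Finset.univ (fun j => A j)}; let dv : Fin n → ℕ → ((Fin n → ℕ) → κ) → ((Fin n → ℕ) → κ) :=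 fun i s c B => c (Function.update B i (B i + s)); let tr : Fin n → (Fin n → κ) → ℕ → ((Fin n → ℕ) → κ) → ((Fin n → ℕ) → κ) := fun i τ s c B => Finset.sum (Fintype.piFinset (fun _ : Fin n => Finset.range (B i + s + 1))) (fun D => @ite κ (D i = 0) (Classical.dec _) (c (B + D) * Finset.prod (Finset.univ.erase i) (fun j => ((Nat.choose (B j + D j) (B j) : ℕ) : κ) * τ j ^ (D j))) 0); let step : Fin n → (Fin n → κ) → ((Fin n → ℕ) → κ) → ((Fin n → ℕ) → κ) := fun i τ c => clean (tr i τ (@ite ℕ (p ≤ ord (clean c)) (Classical.dec _) p 0) (dv i (@ite ℕ (p ≤ ord (clean c)) (Classical.dec _) p 0) (bl i (clean c)))); let run : ((Fin n → ℕ) → κ) → (ℕ → Fin n) → (ℕ → Fin n → κ) → ℕ → ((Fin n → ℕ) → κ) := fun c₀ i t m => @Nat.rec (fun _ => (Fin n → ℕ) → κ) c₀ (fun m c => step (i m) (t m) c) m; let ser : ((Fin n → ℕ) → κ) → MvPowerSeries (Fin n) κ := fun c => show MvPowerSeries (Fin n) κ from fun A : Fin n →₀ ℕ => clean c ⇑A;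 let pd : Fin n → MvPowerSeries (Fin n) κ → MvPowerSeries (Fin n) κ := fun i f => show MvPowerSeries (Fin n) κ from fun A : Fin n →₀ ℕ => ((A i + 1 : ℕ) : κ) * f (A + Finsupp.single i 1); let jac : ((Fin n → ℕ) → κ) → Ideal (MvPowerSeries (Fin n) κ) := fun c => Ideal.span (Set.range (fun i => pd i (ser c))); let Isol : ((Fin n → ℕ) → κ) → Prop := fun c => Module.Finite κ (MvPowerSeries (Fin n) κ ⧸ jac c); let MultP : ((Fin n → ℕ) → κ) → Prop := fun c => (∃ A, clean c A ≠ 0) ∧ ∀ A, clean c A ≠ 0 → p ≤ Finset.sum Finset.univ (fun j => A j); ¬ (∀ m, Isol (run c₀ i t m) ∧ MultP (run c₀ i t m))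

-- `IsolatedForcedTermination` holds: proved by `Summit.ResolutionOfSingularities.ResolutionOfSingularities.Theorems.WildCones.IsolatedForcedTermination_proof` (its module imports this route file, so no `_holds` link can be stated here).

/-- item stmt-ResolutionOfSingularities-16344 · crux · rank 2 · closed · proved by Summit.ResolutionOfSingularities.ResolutionOfSingularities.Theorems.FrobeniusClosing.noPeriodicIsolatedAtom_proof (prover) · by planner
why it might fail: A self-reproducing isolated atom over some F_q (a forced Hauser–Perlega cycle) may simply exist for p ≥ 3, n ≥ 4 — toy C of the spine card already shows μ rising 9→12 at a verified forced step (p = 3, n = 4); nothing known excludes it.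
sources: arXiv:1802.05010, Varshavsky2014, BoubakriGreuelMarkwig2010, arXiv:1412.0868, arXiv:2602.06553, Kollar2007
[crux] THE CERTIFICATE (card frobenius-closes-the-orbit-v2 K2, typed). For every prime p, n ≥ 1 and
field κ ALGEBRAIC over F_p: no start a₀ = c₀ (coefficient function), no word of charts i_m and
translations t_m ∈ κ and no r ≥ 1 such that all states c_0..c_r of the point-blow-up dynamics (blow
up the closed point; in chart i the strict transform divides z^p = a by u_i^p, i.e. z ↦ z/u_i; pass
to the closed point u_j = τ_j (j ≠ i) of the exceptional divisor; delete p-th-power monomials =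
reduce a mod κ[[u]]^p) are ISOLATED (κ[[u]]/(∂_1 a, …, ∂_n a) finite over κ) of multiplicity p
(cleaned order ≥ p), and (κ[[u]], [a_r]) ≅ (κ[[u]], [a_0]) as pairs (∃ κ-automorphism φ of κ[[u]],
unit v, g with φ(a_0) = v^p a_r + g^p). COMPUTE-SEAT JOB SPEC (first source): for (p,n) ∈
{2,3,5}×{3,4,5} enumerate cleaned polynomial states over F_p, F_{p^2}, F_{p^3} with μ ≤ β (β = 20,
40), compute all isolated multiplicity-p successors (n charts × translations in F_{p^m}, m ≤ 3),
quotient by pair-isomorphism via the (2μ−ord+2)-jet normal form, and (a) search the finite successor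
graph for CYCLES, (b) dually iterate E_N = states with an isolated forced future of length N until
E_N = ∅ (Gröbner/linear algeb -/
@[route_item "route-ResolutionOfSingularities-FrobeniusClosing", crux]
def NoPeriodicIsolatedAtom : Prop :=
  ∀ p : ℕ, p.Prime → ∀ n : ℕ, 0 < n → ∀ (κ : Type) [Field κ] [Algebra (ZMod p) κ] [Algebra.IsAlgebraic (ZMod p) κ] (c₀ : (Fin n → ℕ) → κ) (i : ℕ → Fin n) (t : ℕ → Fin n → κ) (r : ℕ), 0 < r → let clean : ((Fin n → ℕ) → κ) → ((Fin n → ℕ) → κ) := fun c A => @ite κ (∀ j, p ∣ A j) (Classical.dec _) 0 (c A); let bl : Fin n → ((Fin n → ℕ) → κ) → ((Fin n → ℕ) → κ) := fun i c B => @ite κ (Finset.sum (Finset.univ.erase i) (fun j => B j) ≤ B i) (Classical.dec _) (c (Function.update B i (B i - Finset.sum (Finset.univ.erase i) (fun j => B j)))) 0; let ord : ((Fin n → ℕ) → κ) → ℕ := fun c => sInf {m : ℕ | ∃ A, c A ≠ 0 ∧ m = Finset.sum Finset.univ (fun j => A j)}; let dv : Fin n → ℕ → ((Fin n → ℕ)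 → κ) → ((Fin n → ℕ) → κ) := fun i s c B => c (Function.update B i (B i + s)); let tr : Fin n → (Fin n → κ) → ℕ → ((Fin n → ℕ) → κ) → ((Fin n → ℕ) → κ) := fun i τ s c B => Finset.sum (Fintype.piFinset (fun _ : Fin n => Finset.range (B i + s + 1))) (fun D => @ite κ (D i = 0) (Classical.dec _) (c (B + D) * Finset.prod (Finset.univ.erase i) (fun j => ((Nat.choose (B j + D j) (B j) : ℕ) : κ) * τ j ^ (D j))) 0); let step : Fin n → (Fin n → κ) → ((Fin n → ℕ) → κ) → ((Fin n → ℕ) → κ) := fun i τ c => clean (tr i τ (@ite ℕ (p ≤ ord (clean c)) (Classical.dec _) p 0) (dv i (@ite ℕ (p ≤ ord (clean c)) (Classical.dec _) p 0) (bl i (clean c)))); let run : ((Fin n → ℕ) → κ) → (ℕ → Fin n) → (ℕ → Fin n → κ) → ℕ → ((Fin n → ℕ) → κ) := fun c₀ i t m => @Nat.rec (fun _ => (Fin n → ℕ) → κ) c₀ (fun m c => step (i m) (t m) c) m; let ser : ((Fin n → ℕ) → κ) → MvPowerSeries (Fin n) κ := fun c => show MvPowerSeries (Fin n) κ from fun A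 : Fin n →₀ ℕ => clean c ⇑A; let pd : Fin n → MvPowerSeries (Fin n) κ → MvPowerSeries (Fin n) κ := fun i f => show MvPowerSeries (Fin n) κ from fun A : Fin n →₀ ℕ => ((A i + 1 : ℕ) : κ) * f (A + Finsupp.single i 1); let jac : ((Fin n → ℕ) → κ) → Ideal (MvPowerSeries (Fin n) κ) := fun c => Ideal.span (Set.range (fun i => pd i (ser c))); let Isol : ((Fin n → ℕ) → κ) → Prop := fun c => Module.Finite κ (MvPowerSeries (Fin n) κ ⧸ jac c); let MultP : ((Fin n → ℕ) → κ) → Prop := fun c => (∃ A, clean c A ≠ 0) ∧ ∀ A, clean c A ≠ 0 → p ≤ Finset.sum Finset.univ (fun j => A j); let PairIso : ((Fin n → ℕ) → κ) → ((Fin n → ℕ) → κ) → Prop := fun c c' => ∃ (φ : MvPowerSeries (Fin n) κ ≃ₐ[κ] MvPowerSeries (Fin n) κ) (v g : MvPowerSeries (Fin n) κ), IsUnit v ∧ φ (ser c) = v ^ p * ser c' + g ^ p; (∀ m, m ≤ r → Isol (run c₀ i t m) ∧ MultP (run c₀ i t m)) → ¬ PairIso (run c₀ i t 0) (run c₀ i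 t r)

-- `NoPeriodicIsolatedAtom` holds: proved by `Summit.ResolutionOfSingularities.ResolutionOfSingularities.Theorems.FrobeniusClosing.noPeriodicIsolatedAtom_proof` (its module imports this route file, so no `_holds` link can be stated here).

/-- item stmt-ResolutionOfSingularities-16345 · crux · rank 3 · open · by planner
why it might fail: The unforced regime may carry the whole difficulty (CP Rem 3.2: ω rises under a permissible centre in dim 4; HP cycles are unforced): then 'given forced termination' buys nothing and Steer is LuAlphaPTorsor again.
sources: arXiv:1412.0868, arXiv:1802.05010, CutkoskyMourtada2019, NovacoskiSpivakovsky2014, Temkin2013, Literature.Barriers.ResolutionOfSingularities.DimensionFourFrontier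
[crux] STEERING: if no perfect field carries an infinite chain of isolated multiplicity-p infinitely
near points of a height-one atom (IsolatedForcedTermination, the target), then α_p-torsors over
bases regular at the centre are uniformizable along every valuation over every perfect field (the
body of TorsorLUPerfect, inlined). Content: at NON-isolated (unforced) stages a positive-dimensional
permissible centre through the centre of the valuation exists; choose it (maximal E-permissible
coordinate stratum, CossartPiltant2019-style) and show the run returns to the isolated regime or
drops multiplicity — the dictionary model/valuation ↔ coefficient dynamics is ShadowGame's
WinToTorsorLU (0-dimensional reduction NovacoskiSpivakovsky2014, Cohen coefficient fields over
perfect κ, toroidal endgame Kato1994/Niziol2006). [deps: ClosingReduction] [difficulty: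
open-problem] -/
@[route_item "route-ResolutionOfSingularities-FrobeniusClosing", crux]
def Steer : Prop :=
  IsolatedForcedTermination → ∀ p : ℕ, p.Prime → ∀ (k K : Type) [Field k] [CharP k p] [PerfectField k] [Field K] [Algebra k K] (O : ValuationSubring K) (A₀ : Subalgebra k K) (h₀ : A₀.toSubring ≤ O.toSubring) (t : K), A₀.FG → t ^ p ∈ A₀ → IsFractionRing (Algebra.adjoin k (insert t (A₀ : Set K))) K → IsRegularLocalRing (Localization.AtPrime (Ideal.comap (Subring.inclusion h₀) (IsLocalRing.maximalIdeal O))) → ∃ (A : Subalgebra k K) (h : A.toSubring ≤ O.toSubring), A₀ ≤ A ∧ t ∈ A ∧ A.FG ∧ IsFractionRing A K ∧ IsRegularLocalRing (Localization.AtPrime (Ideal.comap (Subring.inclusion h) (IsLocalRing.maximalIdeal O)))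

/-- item stmt-ResolutionOfSingularities-16346 · crux · rank 4 · closed · proved by Summit.ResolutionOfSingularities.ResolutionOfSingularities.Theorems.FrobeniusClosing.BoundedMilnor_proof (prover) · by planner
why it might fail: μ is not known to be monotone under point blow-ups in dim ≥ 3 even in char 0; a kangaroo-type re-coordinatisation could pump μ without bound along an eternal isolated chain (an isolated analogue of HauserPerlega2019's residual-order growth), making closing silent.
sources: arXiv:1802.05010, BoubakriGreuelMarkwig2010, arXiv:1005.4503, Kollar2007
[crux] NO PUMPING (card K1): along every infinite chain of isolated multiplicity-p states of the
point-blow-up dynamics over a perfect field, the Milnor-type colength μ(a_m) = dim κ[[u]]/(∂a_m) is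
bounded. Strictly weaker than termination (implied by it vacuously); it is the one geometric input
the closing lemma needs (bounded μ ⇒ the chain lives in one finite-type determinacy quotient).
[difficulty: L] -/
@[route_item "route-ResolutionOfSingularities-FrobeniusClosing", crux]
def BoundedMilnor : Prop :=
  ∀ p : ℕ, p.Prime → ∀ n : ℕ, 0 < n → ∀ (κ : Type) [Field κ] [CharP κ p] [PerfectField κ] (c₀ : (Fin n → ℕ) → κ) (i : ℕ → Fin n) (t : ℕ → Fin n → κ), let clean : ((Fin n → ℕ) → κ) → ((Fin n → ℕ) → κ) := fun c A => @ite κ (∀ j, p ∣ A j) (Classical.dec _) 0 (c A); let bl : Fin n → ((Fin n → ℕ) → κ) → ((Fin n → ℕ) → κ) := fun i c B => @ite κ (Finset.sum (Finset.univ.erase i) (fun j => B j) ≤ B i) (Classical.dec _) (c (Function.update B i (B i - Finset.sum (Finset.univ.erase i) (fun j => B j)))) 0; let ord : ((Fin n → ℕ) → κ) → ℕ := fun c => sInf {m : ℕ | ∃ A, c A ≠ 0 ∧ m = Finset.sum Finset.univ (fun j => A j)}; let dv : Fin n → ℕ → ((Fin n → ℕ) → κ) → ((Fin n → ℕ) →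 κ) := fun i s c B => c (Function.update B i (B i + s)); let tr : Fin n → (Fin n → κ) → ℕ → ((Fin n → ℕ) → κ) → ((Fin n → ℕ) → κ) := fun i τ s c B => Finset.sum (Fintype.piFinset (fun _ : Fin n => Finset.range (B i + s + 1))) (fun D => @ite κ (D i = 0) (Classical.dec _) (c (B + D) * Finset.prod (Finset.univ.erase i) (fun j => ((Nat.choose (B j + D j) (B j) : ℕ) : κ) * τ j ^ (D j))) 0); let step : Fin n → (Fin n → κ) → ((Fin n → ℕ) → κ) → ((Fin n → ℕ) → κ) := fun i τ c => clean (tr i τ (@ite ℕ (p ≤ ord (clean c)) (Classical.dec _) p 0) (dv i (@ite ℕ (p ≤ ord (clean c)) (Classical.dec _) p 0) (bl i (clean c)))); let run : ((Fin n → ℕ) → κ) → (ℕ → Fin n) → (ℕ → Fin n → κ) → ℕ → ((Fin n → ℕ) → κ) := fun c₀ i t m => @Nat.rec (fun _ => (Fin n → ℕ) → κ) c₀ (fun m c => step (i m) (t m) c) m; let ser : ((Fin n → ℕ) → κ) → MvPowerSeries (Fin n) κ := fun c => show MvPowerSeries (Fin n) κ from fun A : Fin n →₀ ℕ => clean c ⇑A;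 let pd : Fin n → MvPowerSeries (Fin n) κ → MvPowerSeries (Fin n) κ := fun i f => show MvPowerSeries (Fin n) κ from fun A : Fin n →₀ ℕ => ((A i + 1 : ℕ) : κ) * f (A + Finsupp.single i 1); let jac : ((Fin n → ℕ) → κ) → Ideal (MvPowerSeries (Fin n) κ) := fun c => Ideal.span (Set.range (fun i => pd i (ser c))); let Isol : ((Fin n → ℕ) → κ) → Prop := fun c => Module.Finite κ (MvPowerSeries (Fin n) κ ⧸ jac c); let MultP : ((Fin n → ℕ) → κ) → Prop := fun c => (∃ A, clean c A ≠ 0) ∧ ∀ A, clean c A ≠ 0 → p ≤ Finset.sum Finset.univ (fun j => A j); let mu : ((Fin n → ℕ) → κ) → ℕ := fun c => Module.finrank κ (MvPowerSeries (Fin n) κ ⧸ jac c); (∀ m, Isol (run c₀ i t m) ∧ MultP (run c₀ i t m)) → ∃ β : ℕ, ∀ m, mu (run c₀ i t m) ≤ β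

-- `BoundedMilnor` holds: proved by `Summit.ResolutionOfSingularities.ResolutionOfSingularities.Theorems.FrobeniusClosing.BoundedMilnor_proof` (its module imports this route file, so no `_holds` link can be stated here).

/-- item stmt-ResolutionOfSingularities-16347 · crux · rank 5 · closed · proved by Summit.ResolutionOfSingularities.ResolutionOfSingularities.Theorems.FrobeniusClosing.ClosingReduction_proofUncond (prover) · by planner
why it might fail: Two leaks: pair-group (φ, v^p·, +g^p) determinacy must be re-derived from BGM right-determinacy (chains base-change to κ̄: likely routine); the closing lemma's dead-end induction for correspondences (card P1) is hand-checked only — if it needs extra hypotheses the arena must be refined.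
sources: Varshavsky2014, Hrushovski2004, BoubakriGreuelMarkwig2010, Fakhruddin2002, doi:10.14231/ag-2022-020
[crux] CLOSING REDUCTION: NoPeriodicIsolatedAtom → BoundedMilnor → IsolatedForcedTermination. Proof
plan (paper-complete modulo the named facts): (i) finite-type arena W_β = cleaned (2β+2)-jets with μ
≤ β and order ≥ p, pair-isomorphism = orbit relation of a truncated algebraic group (constructible),
successor correspondence T_β constructible by Chevalley, EXACT on classes by finite determinacy
(BoubakriGreuelMarkwig2010: μ < ∞ ⇒ right-(2μ−ord+2)-determined; our group contains right
equivalence); (ii) ClosingLemma (support item; Varshavsky2014 Thm 1 + Cor 2, induction over dead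
ends) gives a periodic T_β-path over a finite field from any infinite one; (iii) unwinding:
transport successor points along pair isomorphisms to realise the periodic class-path as an honest
run over F̄_p, contradicting NoPeriodicIsolatedAtom. [deps: NoPeriodicIsolatedAtom, BoundedMilnor]
[difficulty: L] -/
@[route_item "route-ResolutionOfSingularities-FrobeniusClosing", crux]
def ClosingReduction : Prop :=
  NoPeriodicIsolatedAtom → BoundedMilnor → IsolatedForcedTermination

-- `ClosingReduction` holds: proved by `Summit.ResolutionOfSingularities.ResolutionOfSingularities.Theorems.FrobeniusClosing.ClosingReduction_proofUncond` (its module imports this route file, so no `_holds` link can be stated here).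

/-- item stmt-ResolutionOfSingularities-16161 · crux · rank 6 · open · by planner
why it might fail: Patching LUs into one proper regular model is known only in dim ≤ 3 (Zariski; CossartPiltant2008 Prop 4.9 / Piltant2013 need embedded resolution one dimension down); in dim ≥ 4 no reduction Res ⇐ LU exists even in char 0 (CutkoskyMourtada2019 p.3).
sources: CutkoskyMourtada2019, Temkin2013, CossartPiltant2019, NovacoskiSpivakovsky2014, Literature.Barriers.ResolutionOfSingularities.DimensionFourFrontier
[crux] Zariski patching over PERFECT ground fields: for every prime p, relative local uniformization
(every f.g. R ⊆ O is dominated by a f.g. A ⊆ O with Frac A = K, regular at the centre) for all f.g.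
K/k with k perfect of char p implies that every reduced separated scheme of finite type over every
perfect field of char p has a resolution. Fibrewise identical to Valuative's PatchingRel (stmt-0642)
restricted to perfect k — one patching argument proves both. [difficulty: open-problem] -/
@[route_item "route-ResolutionOfSingularities-FrobeniusClosing", crux]
def PatchingRelPerfect : Prop :=
  ∀ p : ℕ, p.Prime → (∀ (k K : Type) [Field k] [CharP k p] [PerfectField k] [Field K] [Algebra k K], (⊤ : IntermediateField k K).FG → ∀ O : ValuationSubring K, (∀ c : k, algebraMap k K c ∈ O) → ∀ R : Subalgebra k K, R.FG → R.toSubring ≤ O.toSubring → ∃ (A : Subalgebra k K) (h : A.toSubring ≤ O.toSubring), R ≤ A ∧ A.FG ∧ IsFractionRing A K ∧ IsRegularLocalRing (Localization.AtPrime (Ideal.comap (Subring.inclusion h) (IsLocalRing.maximalIdeal O)))) → ∀ (k : Type) [Field k] [CharP k p] [PerfectField k] (X : AlgebraicGeometry.Scheme.{0}) (f : X ⟶ AlgebraicGeometry.Spec (.of k)), AlgebraicGeometry.IsSeparated f → AlgebraicGeometry.LocallyOfFiniteType f → AlgebraicGeometry.QuasiCompact f → AlgebraicGeometry.IsReduced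 X → Literature.AlgebraicGeometry.Resolution.Scheme.HasResolution X

/-- item stmt-ResolutionOfSingularities-16162 · crux · rank 7 · open · by planner
why it might fail: Rests on Temkin2013 Thm 1.3.2 (vendored fact with an unproved leaf in tree: Temkin2013RelativeCurveSmoothFibre) and on Temkin's model dominating the GIVEN R, which needs his relative form; smooth ≠ regular bookkeeping at each tower step.
sources: Temkin2013, arXiv:0804.1554, Literature.AlgebraicGeometry.Resolution.Temkin2013Relative, Literature.Barriers.ResolutionOfSingularities.InseparableBaseChange
[crux] Temkin's inseparable reduction over PERFECT ground fields: for every prime p, LU of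
α_p-torsors over bases regular at the centre (TorsorLUPerfect at p) implies relative LU for every
f.g. K/k, k perfect of char p (Temkin2013 Thm 1.3.2: after a finite purely inseparable L/K an affine
model is uniformized with smooth centre; Frobenius F^n moves it into K (k perfect, so k^{p^n} = k
and the transport is finite); the tower K₀ ⊂ … ⊂ K of degree-p radical steps is climbed by the
torsor crux). Valuative's TorsorToLurel (stmt-10968) is the all-k version. [difficulty: L] -/
@[route_item "route-ResolutionOfSingularities-FrobeniusClosing", crux]
def TorsorToLurelPerfect : Prop :=
  ∀ p : ℕ, p.Prime → (∀ (k K : Type) [Field k] [CharP k p] [PerfectField k] [Field K] [Algebra k K] (O : ValuationSubring K) (A₀ : Subalgebra k K) (h₀ : A₀.toSubring ≤ O.toSubring) (t : K), A₀.FG → t ^ p ∈ A₀ → IsFractionRing (Algebra.adjoin k (insert t (A₀ : Set K))) K → IsRegularLocalRing (Localization.AtPrime (Ideal.comap (Subring.inclusion h₀) (IsLocalRing.maximalIdeal O))) → ∃ (A : Subalgebra k K) (h : A.toSubring ≤ O.toSubring), A₀ ≤ A ∧ t ∈ A ∧ A.FG ∧ IsFractionRing A K ∧ IsRegularLocalRing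 (Localization.AtPrime (Ideal.comap (Subring.inclusion h) (IsLocalRing.maximalIdeal O)))) → ∀ (k K : Type) [Field k] [CharP k p] [PerfectField k] [Field K] [Algebra k K], (⊤ : IntermediateField k K).FG → ∀ O : ValuationSubring K, (∀ c : k, algebraMap k K c ∈ O) → ∀ R : Subalgebra k K, R.FG → R.toSubring ≤ O.toSubring → ∃ (A : Subalgebra k K) (h : A.toSubring ≤ O.toSubring), R ≤ A ∧ A.FG ∧ IsFractionRing A K ∧ IsRegularLocalRing (Localization.AtPrime (Ideal.comap (Subring.inclusion h) (IsLocalRing.maximalIdeal O)))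

/-- item stmt-ResolutionOfSingularities-0549 · crux · rank 8 · open · by planner
why it might fail: Only known mechanism spreads X over a f.g. field of definition and base-changes a resolution over a perfect subfield back; regular is not geometrically regular under inseparable extension (EGA IV 6.7.4), e.g. k = F_p((t)) (Temkin2008 Question 3.3.3 open).
sources: arXiv:math/0703678, Kollar2007, Literature.Barriers.ResolutionOfSingularities.InseparableBaseChange, Literature.Barriers.ResolutionOfSingularities.RegularNotGeometricallyRegular
PerfectToAll: for a prime p, resolution of all reduced separated finite-type schemes over all
PERFECT fields of char p implies ResolutionInChar p (all fields of char p). Expected inputs: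
Neron-Popescu (Stacks 07GC), spreading out, openness of regular locus on excellent schemes;
regularity is not stable under inseparable ground field extension, which is the difficulty. -/
@[route_item "route-ResolutionOfSingularities-FrobeniusClosing", crux]
def DescentPerfectToAll : Prop :=
  ∀ p : ℕ, p.Prime → (∀ (k : Type) [Field k] [CharP k p] [PerfectField k] (X : AlgebraicGeometry.Scheme.{0}) (f : X ⟶ AlgebraicGeometry.Spec (.of k)), AlgebraicGeometry.IsSeparated f → AlgebraicGeometry.LocallyOfFiniteType f → AlgebraicGeometry.QuasiCompact f → AlgebraicGeometry.IsReduced X → Literature.AlgebraicGeometry.Resolution.Scheme.HasResolution X) → Literature.AlgebraicGeometry.Resolution.ResolutionInChar.{0} p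

/-- item stmt-ResolutionOfSingularities-16158 · support · rank 9 · open · by planner
sources: Temkin2013, CutkoskyMourtada2019, CossartPiltant2019, Literature.Barriers.ResolutionOfSingularities.DimensionFourFrontier
[target] local uniformization of α_p-torsors over bases regular at the centre, over PERFECT ground
fields: k perfect of char p, K/k, O a valuation ring of K, A₀ ⊆ O f.g. regular at the centre, t ∈ K
with t^p ∈ A₀ and Frac(A₀[t]) = K ⇒ some f.g. A with A₀[t] ⊆ A ⊆ O, Frac A = K, A regular at the
centre (Valuative's LuAlphaPTorsor, stmt-0641, with [PerfectField k] added). Derived in `closes` as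
WinToTorsorLU applied to ShadowGameWin. -/
@[route_item "route-ResolutionOfSingularities-FrobeniusClosing"]
def TorsorLUPerfect : Prop :=
  ∀ p : ℕ, p.Prime → ∀ (k K : Type) [Field k] [CharP k p] [PerfectField k] [Field K] [Algebra k K] (O : ValuationSubring K) (A₀ : Subalgebra k K) (h₀ : A₀.toSubring ≤ O.toSubring) (t : K), A₀.FG → t ^ p ∈ A₀ → IsFractionRing (Algebra.adjoin k (insert t (A₀ : Set K))) K → IsRegularLocalRing (Localization.AtPrime (Ideal.comap (Subring.inclusion h₀) (IsLocalRing.maximalIdeal O))) → ∃ (A : Subalgebra k K) (h : A.toSubring ≤ O.toSubring), A₀ ≤ A ∧ t ∈ A ∧ A.FG ∧ IsFractionRing A K ∧ IsRegularLocalRing (Localization.AtPrime (Ideal.comap (Subring.inclusion h) (IsLocalRing.maximalIdeal O)))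

/-- item stmt-ResolutionOfSingularities-16348 · support · rank 9 · open · by planner
sources: Varshavsky2014, Hrushovski2004, Fakhruddin2002, doi:10.14231/ag-2022-020
[support] THE CLOSING LEMMA, affine constructible form (card P1): p prime, T ⊆ A^N × A^N a
constructible set defined over F_p (finite union of V(P_j) ∖ V(Q_j)); if T has an infinite path with
vertices in K^N for SOME field K of characteristic p, then T has a PERIODIC path with vertices in
F^N for some FINITE field F. Proof: survivor sets are constructible and non-empty over F̄_p; on a
bi-dominant irreducible piece Varshavsky2014 Thm 1/Cor 2 (the graph of Frob_q^m meets it, densely)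
gives an honest path γ with last(γ) = Frob^m(first(γ)) off every bad locus, iterated by
F_q-equivariance to a periodic path; otherwise pass to a lower-dimensional closed sub-arena
(induction on dimension; dim 0 = pigeonhole). Needs the twisted Lang–Weil estimate as a vendored
Literature fact (cite item filed). [difficulty: M] -/
@[route_item "route-ResolutionOfSingularities-FrobeniusClosing"]
def ClosingLemma : Prop :=
  ∀ p : ℕ, p.Prime → ∀ (N k : ℕ) (P Q : Fin k → Finset (MvPolynomial (Fin N ⊕ Fin N) (ZMod p))), (∃ (K : Type) (_ : Field K) (_ : Algebra (ZMod p) K) (w : ℕ → Fin N → K), ∀ m, ∃ j, (∀ f ∈ P j, MvPolynomial.aeval (Sum.elim (w m) (w (m + 1))) f = 0) ∧ ∃ g ∈ Q j, MvPolynomial.aeval (Sum.elim (w m) (w (m + 1))) g ≠ 0) → ∃ (F : Type) (_ : Field F) (_ : Algebra (ZMod p) F) (_ : Finite F) (w : ℕ → Fin N → F) (r : ℕ), 0 < r ∧ (∀ m, w (m + r) = w m) ∧ ∀ m, ∃ j, (∀ f ∈ P j, MvPolynomial.aeval (Sum.elim (w m) (w (m + 1))) f = 0) ∧ ∃ g ∈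 Q j, MvPolynomial.aeval (Sum.elim (w m) (w (m + 1))) g ≠ 0

/-- item stmt-ResolutionOfSingularities-16349 · assembly · rank 1 · closed · proved by Summit.ResolutionOfSingularities.ResolutionOfSingularities.Theorems.FrobeniusClosing.assembly_proof (prover) · by planner
sources: Varshavsky2014, Temkin2013, NovacoskiSpivakovsky2014
[assembly] NoPeriodicIsolatedAtom → BoundedMilnor → ClosingReduction → Steer → TorsorToLurelPerfect
→ PatchingRelPerfect → DescentPerfectToAll → ResolutionOfSingularities. -/
@[route_item "route-ResolutionOfSingularities-FrobeniusClosing"]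
def Assembly : Prop :=
  NoPeriodicIsolatedAtom → BoundedMilnor → ClosingReduction → Steer → TorsorToLurelPerfect → PatchingRelPerfect → DescentPerfectToAll → _root_.ResolutionOfSingularities

-- `Assembly` holds: proved by `Summit.ResolutionOfSingularities.ResolutionOfSingularities.Theorems.FrobeniusClosing.assembly_proof` (its module imports this route file, so no `_holds` link can be stated here).

/-! D-0027 §2.1 — DECIDING THEOREM (planner-authored via `route open/edit --closes-file`; by planner-plan-novel-ResolutionOfSingularities-Re-dc19aa3a-d-v 2026-08-16T18:37:19Z):
its hypotheses are this route's items and its conclusion the sub-problem Statement (glue_lint), and it elaborates with this file. -/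

@[closes "route-ResolutionOfSingularities-FrobeniusClosing"] theorem closes (hNP : NoPeriodicIsolatedAtom) (hBT : BoundedMilnor) (hCR : ClosingReduction) (hS : Steer)
    (hT : TorsorToLurelPerfect) (hP : PatchingRelPerfect) (hD : DescentPerfectToAll) : _root_.ResolutionOfSingularities :=
  fun p hp => hD p hp (hP p hp (hT p hp (hS (hCR hNP hBT) p hp)))

end Summit.ResolutionOfSingularities.ResolutionOfSingularities.Theses.FrobeniusClosing
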